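import Mathlib
import Summits.ValiantsHypothesis.ValiantsHypothesis.Theorems.BarrierLeverDefinableEquationsProductDepthSlice

/-!
# Route BarrierLever — the constant product-depth slice phrased with the tree's measure
# `productDepthCircuitSize` (`ℕ∞`, Literature `CircuitDepth.lean`; val-np-p5 g8, companion of
# `…ProductDepthSlice.lean`)

`naturalProofsAgainstProductDepthCircuitSize`: for every `b` and `Δ ≥ 1`, eventually in `n`, the
degree-`≤ n` polynomials `f` with `productDepthCircuitSize Δ f ≤ n^b` are not a succinct hitting set
for `Distinguishers ℂ n a` — `LSTSlice.naturalProofsAgainstProductDepth` (p530694) transported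
along `exists_circuit_of_productDepthCircuitSize_le` (a finite bound on the `ℕ∞`-valued infimum is
witnessed by a circuit: an infimum of gate counts all `> m` is `≥ m + 1`).  What this is NOT:
nothing beyond p530694 (constant product-depth only; crux b = 2 OPEN; nothing on `VP ≠ VNP`).
No definitions, no named facts.
-/

-- `Summit.ValiantsHypothesis.ValiantsHypothesis.…` repeats a component by the D-0017 layout
-- (single-conjunct summit), which the `dupNamespace` linter flags; the name is mandated.
set_option linter.dupNamespace false

noncomputable section

namespace Summit.ValiantsHypothesis.ValiantsHypothesis.Theorems.BarrierLeverDefinableEquations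

open MvPolynomial
open Literature.Computability.AlgebraicComplexity Literature.Barriers.ValiantsHypothesis
open scoped BigOperators

namespace LSTSlice

/-- A finite bound on `productDepthCircuitSize Δ f` is witnessed by a circuit. [folklore] -/
theorem exists_circuit_of_productDepthCircuitSize_le {n Δ m : ℕ} {f : MvPolynomial (Fin n) ℂ}
    (h : productDepthCircuitSize Δ f ≤ (m : ℕ∞)) :
    ∃ P : ArithCircuit ℂ (Fin n), P.Computes f ∧ P.size ≤ m ∧ P.productDepth ≤ Δ := by
  by_contra hno
  push Not at hno
  have hle : ((m + 1 : ℕ) : ℕ∞) ≤ productDepthCircuitSize Δ f := by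
    refine le_iInf₂ fun P hP => ?_
    have hlt : m < P.size := by
      by_contra hs
      exact absurd (hno P hP.1 (not_lt.mp hs)) (not_lt.mpr hP.2)
    exact_mod_cast Nat.succ_le_of_lt hlt
  have := ENat.coe_le_coe.mp (hle.trans h)
  omega

/-- **`naturalProofsAgainstProductDepth` with the tree's measure**: eventually in `n`, the
degree-`≤ n` polynomials with `productDepthCircuitSize Δ f ≤ n^b` are not a succinct hitting set
for `Distinguishers ℂ n a`. [cite: LimayeSrinivasanTavenas2025, Cor. 4] -/
theorem naturalProofsAgainstProductDepthCircuitSize (b Δ : ℕ) (hΔ : 1 ≤ Δ) :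
    ∃ a n₀ : ℕ, ∀ n ≥ n₀, ¬ IsSuccinctHittingSet (degLEMonomials n)
      {f : MvPolynomial (Fin n) ℂ | f.totalDegree ≤ n ∧
        productDepthCircuitSize Δ f ≤ ((n ^ b : ℕ) : ℕ∞)} (Distinguishers ℂ n a) := by
  obtain ⟨a, n₀, h⟩ := naturalProofsAgainstProductDepth b Δ hΔ
  refine ⟨a, n₀, fun n hn hS => h n hn (hS.mono ?_ le_rfl)⟩
  rintro f ⟨hf, hle⟩
  obtain ⟨P, hPf, hPs, hPΔ⟩ := exists_circuit_of_productDepthCircuitSize_le hle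
  exact ⟨hf, P, hPf, hPs, hPΔ⟩

end LSTSlice

end Summit.ValiantsHypothesis.ValiantsHypothesis.Theorems.BarrierLeverDefinableEquations
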